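import Summits.Ventures.HSemireg.WedgeHankelClassSpaceRaisingJordanType
import Summits.Ventures.HSemireg.WedgeHankelSubstitutionKernelFlag
import Mathlib.Data.Nat.Choose.Lucas

/-!
# Venture HSemireg — SAME JORDAN TYPE, DIFFERENT FLAGS: in characteristic `p` the raising operator `e` and the shear `S_λ − 1` have the same kernel dimensions (L6), but
# **`ker e = ker (S_λ − 1)` if and only if `n ≤ 2p − 2`**: the spike `E_{p−1}` is killed by `e` always, and by `S_λ − 1` exactly when `n < 2p − 1` (the `E_{2p−1}`-coordinate of
# `(S_λ − 1) E_{p−1}` is `C(2p−1, p−1)·λ^p`, a unit by Lucas)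

HONEST FRAMING. Part of the Lean index of the computation cell `pub-hsemireg` (seat p10 gen 24, Sunday typer «UNIFORM-IN-n»).
Finite-dimensional linear algebra of endomorphisms of th-7's class space + Lucas' congruence for one binomial coefficient ONLY: no variety, no cohomology theory, no sheaf, no Ext group,
no semiregularity map; nothing here says that HC / HC_CM / HC_AV holds; no Literature fact is declared or used.  Custodian versions as in `WedgeHankelSiegelIdeal` (1/3) and
`WedgeHankelFrameChange`; the dictionary (`e` = the infinitesimal shear on `Sym^n`, `S_λ = SbC(1 λ 0 1)` = the substitution `Θ ↦ Θ + λ`) is QUOTED, never asserted.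

WHAT IS IN THE TREE.  L6 (`WedgeHankelClassSpaceRaisingJordanType`): `ker_pow_raising_eq_span` (`ker e^k` is spike-spanned), `finrank_ker_pow_raising_eq_finrank_ker_pow_shear_charP` (SAME JORDAN
TYPE); K-series: `repr_SbC_shear_sub_one`, `sbMat_shear_apply` (the shear's matrix `C(a,l) λ^{a−l}` on the spikes), `spikeBasis_mem_ker_SbC_shear_sub_one_pow` (top spikes); K27's
hypotheses `hE hEtop` (`e E_i = (i+1) E_{i+1}`, `e E_n = 0`); Mathlib's `Choose.choose_modEq_choose_mod_mul_choose_div_nat` (Lucas, one step).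
THIS FILE (namespace `Summit.Ventures.HSemireg.Wedge.HankelFrameChange` continued):
* §408 `repr_shear_sub_one_spikeBasis` (**`(S_λ − 1) E_i = Σ_{a > i} C(a,i) λ^{a−i} E_a`**, every field), `choose_pred_cast_eq_zero_charP` (`C(a, p−1) = 0` in `K` for `p ≤ a ≤ 2p−2`),
  `choose_two_mul_pred_cast_ne_zero_charP` (`C(2p−1, p−1) ≠ 0` in `K`), `shear_sub_one_spikeBasis_eq_zero_of_le` (`n ≤ 2p−2 ⇒ (S_λ − 1) E_{p−1} = 0`),
  `repr_shear_sub_one_spikeBasis_ne_zero` / **`spikeBasis_notMem_ker_shear_sub_one`** (`n ≥ 2p−1 ⇒ E_{p−1} ∉ ker (S_λ − 1)`, `λ ≠ 0`).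
* §409 `spikeBasis_mem_ker_raising_of_cast_eq_zero` (`(i+1) = 0` in `K` ⇒ `E_i ∈ ker e`), `ker_raising_le_ker_shear_sub_one_of_le`, **`ker_raising_eq_ker_shear_sub_one_of_le`**
  (`n ≤ 2p−2 ⇒ ker e = ker (S_λ − 1)`), **`ker_raising_ne_ker_shear_sub_one_of_ge`** (`n ≥ 2p−1 ⇒ ker e ≠ ker (S_λ − 1)`), **`ker_raising_eq_ker_shear_sub_one_iff`**
  (`ker e = ker (S_λ − 1) ↔ n ≤ 2p − 2`), and the two non-inclusions `not_ker_raising_le_ker_shear_sub_one`, `not_ker_shear_sub_one_le_ker_raising` for `n ≥ 2p − 1` (equal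
  dimension, neither contains the other).
READING: L6/L10's «the four nilpotents have one Jordan type» is a statement about dimensions only; the invariant FLAGS differ as soon as the class space is long enough to hold the
spike `E_{2p−1}` — below that length the two kernels literally coincide.  Nothing Ext-side.  New names only.
-/

open Module

namespace Summit.Ventures.HSemireg.Wedge.HankelFrameChange

open Summit.Ventures.HSemireg.Wedge Summit.Ventures.HSemireg.Wedge.Kunneth Summit.Ventures.HSemireg.Wedge.Hankel
  Summit.Ventures.HSemireg.Wedge.BasisFree Summit.Ventures.HSemireg.Wedge.HankelSiegel Summit.Ventures.HSemireg.Wedge.HankelSiegelIdeal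
  Summit.Ventures.HSemireg.Wedge.KunnethKernel Summit.Ventures.HSemireg.Wedge.HankelRankOne Summit.Ventures.HSemireg.Wedge.KernelDuality

variable (K : Type*) [Field K] {n : ℕ}

/-! ## §408. The shear on a spike; the binomial coefficient `C(2p−1, p−1)` -/

/-- **`(S_λ − 1) E_i = Σ_{a > i} C(a,i) λ^{a−i} E_a`**: the spike coordinates of the shear minus one on a spike (every field). -/
theorem repr_shear_sub_one_spikeBasis (lam : K) (i a : Fin (n + 1)) :
    (spikeBasis K n).repr ((SbC K 1 lam 0 1 - 1) (spikeBasis K n i)) a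
      = if (i : ℕ) < a then ((((a : ℕ).choose (i : ℕ) : ℕ) : K) * lam ^ ((a : ℕ) - (i : ℕ))) else 0 := by
  rw [repr_SbC_shear_sub_one, Finset.sum_eq_single i]
  · rw [Basis.repr_self, Finsupp.single_apply, if_pos rfl, mul_one, Matrix.sub_apply, sbMat_shear_apply, Matrix.one_apply]
    by_cases h : (i : ℕ) < a
    · rw [if_pos h, if_pos (le_of_lt h), if_neg (fun e => by rw [e] at h; exact lt_irrefl _ h), sub_zero]
    · rw [if_neg h]
      by_cases hia : a = i
      · subst hia
        rw [if_pos le_rfl, if_pos rfl, Nat.choose_self, Nat.sub_self, pow_zero, Nat.cast_one, mul_one, sub_self]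
      · rw [if_neg (fun hle => hia (Fin.ext (by omega))), if_neg hia, sub_zero]
  · intro j _ hj
    rw [Basis.repr_self, Finsupp.single_apply, if_neg (fun h => hj h.symm), mul_zero]
  · intro h
    exact absurd (Finset.mem_univ i) h

/-- Lucas, one step: **`C(a, p−1) = 0` in characteristic `p` for `p ≤ a ≤ 2p − 2`** (`a = (1, a−p)` and `p−1 = (0, p−1)` in base `p`, with `a − p < p − 1`). -/
theorem choose_pred_cast_eq_zero_charP (p : ℕ) [Fact p.Prime] [CharP K p] {a : ℕ} (hpa : p ≤ a) (ha : a ≤ 2 * p - 2) :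
    (((a.choose (p - 1) : ℕ)) : K) = 0 := by
  rw [CharP.cast_eq_zero_iff K p]
  have hp := (Fact.out : p.Prime).one_lt
  have h := (Choose.choose_modEq_choose_mod_mul_choose_div_nat (n := a) (k := p - 1) (p := p))
  have h1 : a % p = a - p := by rw [Nat.mod_eq_sub_mod hpa, Nat.mod_eq_of_lt (by omega)]
  have h2 : (p - 1) % p = p - 1 := Nat.mod_eq_of_lt (by omega)
  rw [h1, h2, Nat.choose_eq_zero_of_lt (by omega : a - p < p - 1), zero_mul] at h
  exact Nat.modEq_zero_iff_dvd.mp h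

/-- Lucas, one step: **`C(2p−1, p−1) ≠ 0` in characteristic `p`** (`2p−1 = (1, p−1)`, `p−1 = (0, p−1)` in base `p`: `C(1,0)·C(p−1,p−1) = 1`). -/
theorem choose_two_mul_pred_cast_ne_zero_charP (p : ℕ) [Fact p.Prime] [CharP K p] :
    ((((2 * p - 1).choose (p - 1) : ℕ)) : K) ≠ 0 := by
  rw [Ne, CharP.cast_eq_zero_iff K p]
  have hp := (Fact.out : p.Prime).one_lt
  have h := (Choose.choose_modEq_choose_mod_mul_choose_div_nat (n := 2 * p - 1) (k := p - 1) (p := p))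
  have h1 : (2 * p - 1) % p = p - 1 := by rw [Nat.mod_eq_sub_mod (by omega : p ≤ 2 * p - 1), Nat.mod_eq_of_lt (by omega)]; omega
  have h2 : (p - 1) % p = p - 1 := Nat.mod_eq_of_lt (by omega)
  have h3 : (2 * p - 1) / p = 1 := Nat.div_eq_of_lt_le (by omega) (by omega)
  have h4 : (p - 1) / p = 0 := Nat.div_eq_of_lt (by omega)
  rw [h1, h2, h3, h4, Nat.choose_self, Nat.choose_zero_right, mul_one] at h
  intro hdvd
  have h5 : 1 ≡ 0 [MOD p] := h.symm.trans (Nat.modEq_zero_iff_dvd.mpr hdvd)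
  have h6 := Nat.le_of_dvd one_pos (Nat.modEq_zero_iff_dvd.mp h5)
  omega

/-- **`n ≤ 2p − 2 ⇒ (S_λ − 1) E_{p−1} = 0`**: every coordinate `C(a, p−1) λ^{a−p+1}`, `p ≤ a ≤ n`, vanishes in characteristic `p`. -/
theorem shear_sub_one_spikeBasis_eq_zero_of_le (p : ℕ) [Fact p.Prime] [CharP K p] (lam : K) {i : Fin (n + 1)} (hi : (i : ℕ) + 1 = p) (hn : n ≤ 2 * p - 2) :
    (SbC K 1 lam 0 1 - 1) (spikeBasis K n i) = 0 := by
  apply (spikeBasis K n).repr.injective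
  rw [map_zero]
  ext a
  rw [repr_shear_sub_one_spikeBasis, Finsupp.coe_zero, Pi.zero_apply]
  by_cases h : (i : ℕ) < a
  · have ha := a.2
    rw [if_pos h, show (i : ℕ) = p - 1 by omega, choose_pred_cast_eq_zero_charP K p (by omega) (by omega), zero_mul]
  · rw [if_neg h]

/-- `n ≥ 2p − 1`: the `E_{2p−1}`-coordinate of `(S_λ − 1) E_{p−1}` is `C(2p−1, p−1) · λ^p ≠ 0` (`λ ≠ 0`). -/
theorem repr_shear_sub_one_spikeBasis_ne_zero (p : ℕ) [Fact p.Prime] [CharP K p] {lam : K} (hlam : lam ≠ 0) {i a : Fin (n + 1)} (hi : (i : ℕ) + 1 = p)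
    (ha : (a : ℕ) + 1 = 2 * p) : (spikeBasis K n).repr ((SbC K 1 lam 0 1 - 1) (spikeBasis K n i)) a ≠ 0 := by
  have hp := (Fact.out : p.Prime).one_lt
  rw [repr_shear_sub_one_spikeBasis, if_pos (by omega), show (a : ℕ) = 2 * p - 1 by omega, show (i : ℕ) = p - 1 by omega]
  exact mul_ne_zero (choose_two_mul_pred_cast_ne_zero_charP K p) (pow_ne_zero _ hlam)

/-- **`n ≥ 2p − 1 ⇒ E_{p−1} ∉ ker (S_λ − 1)`** (`λ ≠ 0`, characteristic `p`). -/
theorem spikeBasis_notMem_ker_shear_sub_one (p : ℕ) [Fact p.Prime] [CharP K p] {lam : K} (hlam : lam ≠ 0) (hn : 2 * p - 1 ≤ n) {i : Fin (n + 1)} (hi : (i : ℕ) + 1 = p) :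
    spikeBasis K n i ∉ LinearMap.ker (SbC K 1 lam 0 1 - 1) := by
  have hp := (Fact.out : p.Prime).one_lt
  intro h
  rw [LinearMap.mem_ker] at h
  have h2 := repr_shear_sub_one_spikeBasis_ne_zero K p hlam hi (a := ⟨2 * p - 1, by omega⟩) (by simp only; omega)
  rw [h, map_zero, Finsupp.coe_zero, Pi.zero_apply] at h2
  exact h2 rfl

/-! ## §409. The kernel flags of `e` and of the shear agree iff `n ≤ 2p − 2` -/

section RaisingShear

variable {e : Module.End K (spikeSpan K n)}
  (hE : ∀ (i : Fin (n + 1)) (hi : (i : ℕ) < n), e (spikeBasis K n i) = (((i : ℕ) : K) + 1) • spikeBasis K n ⟨(i : ℕ) + 1, by omega⟩) (hEtop : e (spikeBasis K n (Fin.last n)) = 0)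
include hE hEtop

omit hEtop in
/-- `(i + 1) = 0` in `K` ⇒ `E_i ∈ ker e` (for `i < n`; the top spike is killed anyway). -/
theorem spikeBasis_mem_ker_raising_of_cast_eq_zero {i : Fin (n + 1)} (hi : (i : ℕ) < n) (h : ((((i : ℕ) + 1 : ℕ)) : K) = 0) :
    spikeBasis K n i ∈ LinearMap.ker e := by
  rw [LinearMap.mem_ker, hE i hi, show (((i : ℕ) : K) + 1) = ((((i : ℕ) + 1 : ℕ)) : K) by push_cast; ring, h, zero_smul]

/-- `n ≤ 2p − 2 ⇒ ker e ≤ ker (S_λ − 1)`: `ker e` is spanned by the top spike and the spikes `E_i` with `p ∣ i + 1`, i.e. by `E_n` and (if `p − 1 ≤ n`) `E_{p−1}` — both killed by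
`S_λ − 1` while `n ≤ 2p − 2` (§408). -/
theorem ker_raising_le_ker_shear_sub_one_of_le (p : ℕ) [Fact p.Prime] [CharP K p] (lam : K) (hn : n ≤ 2 * p - 2) :
    LinearMap.ker e ≤ LinearMap.ker (SbC K 1 lam 0 1 - 1) := by
  have hp := (Fact.out : p.Prime).one_lt
  have h := ker_pow_raising_eq_span K hE hEtop 1
  rw [pow_one] at h
  rw [h, Submodule.span_le]
  rintro _ ⟨⟨i, hi⟩, rfl⟩
  rw [SetLike.mem_coe]
  rcases hi with hi | hi
  · have h1 := spikeBasis_mem_ker_SbC_shear_sub_one_pow K lam (k := 1) hi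
    rwa [pow_one] at h1
  · rw [Nat.ascFactorial_succ, Nat.ascFactorial_zero, add_zero, mul_one] at hi
    obtain ⟨c, hc⟩ := (CharP.cast_eq_zero_iff K p _).mp hi
    have hi2 := i.2
    have hip : (i : ℕ) + 1 = p := by
      rcases c with _ | c
      · omega
      · rcases c with _ | c
        · omega
        · have : p * (c + 1 + 1) = p * c + p + p := by ring
          omega
    exact LinearMap.mem_ker.mpr (shear_sub_one_spikeBasis_eq_zero_of_le K p lam hip hn)

/-- **`n ≤ 2p − 2 ⇒ ker e = ker (S_λ − 1)`** (`λ ≠ 0`, characteristic `p`): inclusion (above) and equal dimension (L6). -/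
theorem ker_raising_eq_ker_shear_sub_one_of_le (p : ℕ) [Fact p.Prime] [CharP K p] {lam : K} (hlam : lam ≠ 0) (hn : n ≤ 2 * p - 2) :
    LinearMap.ker e = LinearMap.ker (SbC K 1 lam 0 1 - 1) := by
  refine Submodule.eq_of_le_of_finrank_eq (ker_raising_le_ker_shear_sub_one_of_le K hE hEtop p lam hn) ?_
  have h := finrank_ker_pow_raising_eq_finrank_ker_pow_shear_charP K hE hEtop p hlam 1
  rwa [pow_one, pow_one] at h

omit hEtop in
/-- **`n ≥ 2p − 1 ⇒ ¬ ker e ≤ ker (S_λ − 1)`**: `E_{p−1} ∈ ker e` but `(S_λ − 1) E_{p−1}` has the coordinate `C(2p−1, p−1) λ^p ≠ 0` at `E_{2p−1}`. -/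
theorem not_ker_raising_le_ker_shear_sub_one (p : ℕ) [Fact p.Prime] [CharP K p] {lam : K} (hlam : lam ≠ 0) (hn : 2 * p - 1 ≤ n) :
    ¬ LinearMap.ker e ≤ LinearMap.ker (SbC K 1 lam 0 1 - 1) := by
  have hp := (Fact.out : p.Prime).one_lt
  intro hle
  have hmem : spikeBasis K n ⟨p - 1, by omega⟩ ∈ LinearMap.ker e :=
    spikeBasis_mem_ker_raising_of_cast_eq_zero K hE (by simp only; omega) (by rw [show (p - 1 + 1 : ℕ) = p by omega]; exact CharP.cast_eq_zero K p)
  exact spikeBasis_notMem_ker_shear_sub_one K p hlam hn (by simp only; omega) (hle hmem)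

/-- **`n ≥ 2p − 1 ⇒ ¬ ker (S_λ − 1) ≤ ker e`** either (equal dimensions, L6): neither kernel contains the other. -/
theorem not_ker_shear_sub_one_le_ker_raising (p : ℕ) [Fact p.Prime] [CharP K p] {lam : K} (hlam : lam ≠ 0) (hn : 2 * p - 1 ≤ n) :
    ¬ LinearMap.ker (SbC K 1 lam 0 1 - 1) ≤ LinearMap.ker e := by
  intro hle
  have h := finrank_ker_pow_raising_eq_finrank_ker_pow_shear_charP K hE hEtop p hlam 1
  rw [pow_one, pow_one] at h
  have heq := Submodule.eq_of_le_of_finrank_eq hle h.symm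
  exact not_ker_raising_le_ker_shear_sub_one K hE p hlam hn heq.symm.le

omit hEtop in
/-- **`n ≥ 2p − 1 ⇒ ker e ≠ ker (S_λ − 1)`.** -/
theorem ker_raising_ne_ker_shear_sub_one_of_ge (p : ℕ) [Fact p.Prime] [CharP K p] {lam : K} (hlam : lam ≠ 0) (hn : 2 * p - 1 ≤ n) :
    LinearMap.ker e ≠ LinearMap.ker (SbC K 1 lam 0 1 - 1) :=
  fun h => not_ker_raising_le_ker_shear_sub_one K hE p hlam hn h.le

/-- **SAME JORDAN TYPE, DIFFERENT FLAGS: `ker e = ker (S_λ − 1) ↔ n ≤ 2p − 2`** (`λ ≠ 0`, characteristic `p`; L6 gives `dim ker e^k = dim ker (S_λ − 1)^k` for every `k` and `n`). -/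
theorem ker_raising_eq_ker_shear_sub_one_iff (p : ℕ) [Fact p.Prime] [CharP K p] {lam : K} (hlam : lam ≠ 0) :
    LinearMap.ker e = LinearMap.ker (SbC K 1 lam 0 1 - 1) ↔ n ≤ 2 * p - 2 :=
  ⟨fun h => by
    by_contra hn
    exact ker_raising_ne_ker_shear_sub_one_of_ge K hE p hlam (by omega) h,
   fun hn => ker_raising_eq_ker_shear_sub_one_of_le K hE hEtop p hlam hn⟩

end RaisingShear

end Summit.Ventures.HSemireg.Wedge.HankelFrameChange
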